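import Literature.Computability.QuantumComplexity.EvenSVTEndToEnd
import HarnessLib

/-!
# The operator-norm layer of the even singular value transformation: a typeclass-free
# operator-norm certificate on real sketches, and the vector stage of CGLLTW Theorem 3.4
# (even case) at degree exponent 2

Chia, Gilyén, Li, Lin, Tang, Wang, J. ACM 69(5):33 (2022) = arXiv:1910.06151 (`ChiaEtAl2022`),
§3.3 proof of Theorem 3.4, even case, the vector step `‖Rb − u‖ ≤ ε/d` with
`Õ(‖A‖_F²‖b‖²d²/ε²)` samples via `‖R†f̄(CC†)(Rb − u)‖ ≤ ‖R†√f̄(CC†)‖‖√f̄(CC†)‖‖Rb − u‖` (held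
arXiv text p. 21 L12–19) and §5.3 (eq:evenSVTbdRC) `‖R†√f̄(CC†)‖ = √‖R†f̄(CC†)R‖` (p. 37 L134–138).

THESIS.  The tree's `even_polynomial_svt_end_to_end` sizes this vector stage by the Frobenius
surrogate `‖RᵀM‖_F ≤ 2k²‖R‖_F` (`frobSq_transpose_mul_kernel_le`): `σ ≥ 144φ²φ_b k⁴‖A‖_F⁴/η²` per
copy, degree exponent `4` (`d = 2k`) — `Fin s → ℝ` carries no Euclidean operator norm in the
tree's currency.  This file adds the missing column of the access-model dictionary, the
OPERATOR-NORM CERTIFICATE `OpNormLe X L :↔ ∀ w, ‖Xw‖ ≤ L‖w‖` (a predicate with proved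
constructors and a typeclass-free quadratic-form toolkit over Mathlib's
`Matrix.IsHermitian.eigenvectorUnitary`, §1), and the deterministic OPERATOR LAYER (§2,
`opNormLe_kernel_of_sketch_events`): on the two sketch events of the even construction
(`‖RᵀR − AᵀA‖_F ≤ θ₁`, `‖RRᵀ − CCᵀ‖_F ≤ θ₂`), `‖Rᵀq̄_clamp(CCᵀ)‖_op² ≤ 4k²(1+θ₁+θ₂) + 4k⁴θ₂`.
Through the event-exposing two-stage theorem (§3) and the boosted vector step (§4), the
end-to-end statement holds with **`σ ≥ 216 φ φ_b k² ‖A‖_F²/η²`** per copy (§5,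
`even_polynomial_svt_end_to_end_op`; beside the tree's `72φ²φ_bd⁴‖A‖_F⁴ℓ'/η²` samples in all and
the print's `Õ(‖A‖_F²‖b‖²d²/ε²)`): degree exponent `2`.

SIGN CAVEAT, and why the layer is sign-free.  The print's `‖R†√f̄(CC†)‖² = ‖R†f̄(CC†)R‖` needs
`f̄(CC†) ⪰ 0`, but Theorem 3.4 quantifies over every `q` (`deg q ≤ k`, `|q| ≤ 1` on `[0,1]`) and
`q̄(x) = (q(x) − q(0))/x` changes sign in general (`q = 8x(1−x)(2x−1)`); the final matrix event is
even blind to `‖RᵀM‖` for indefinite `M` (`matrix_event_blind_example`: `RᵀMR = 0`, `RᵀM ≠ 0`).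
The layer uses instead that `M = q̄_c(CCᵀ)` COMMUTES with `CCᵀ`:
`‖RᵀMw‖² = ⟨Mw, CCᵀMw⟩ + ⟨Mw, (RRᵀ − CCᵀ)Mw⟩`, the first term being `Σ_i λ_i q̄_c(λ_i)²y_i²` with
`λq̄_c(λ)² = (q(λ) − q(0))·q̄(λ) ≤ 2·2k²` (`mul_qbarClamp_sq_le`) — no square root of `M`.
NEAREST PRINT: Le Gall's robust re-derivation (arXiv:2304.04932 = Comput. Complexity 34 (2025),
even-SVT section, arXiv p. 26) is sign-free too but sizes the step by `‖R†‖‖f̄(CC†)‖‖u − Rb‖ ≤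
2L_max‖u − Rb‖`, `r' = O(φ²d⁴log(1/δ)/(η²‖p(√A†A)b‖²))`: exponent `4`, the tree's.

HONEST PRICE AND SCOPE.  The print's `‖R‖ = O(‖A‖)` (Lemma "AMP-spectral", Rudelson–Vershynin)
is NOT used or formalised: the layer pays the Frobenius events `θ₁, θ₂` inside `Λ = 1 + θ₁ + θ₂`,
so the matrix-stage thresholds (incl. the dominant `s·c` entry count) stay in the tree's Frobenius
currency and ONLY the vector stage moves `d⁴‖A‖_F⁴ → d²‖A‖_F²`.  Sample counts only — no
algorithm, running time or query model; even case; real matrices; constants explicit, not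
optimised; not typed here: odd case, operator-norm matrix stage, running time, complex field.
Nothing in this file bears on BQP vs BPP.

THEOREM MAP.  §1 `OpNormLe` (`.of_sq_le`, `.of_frobSq`, `.zero`), `OpNorm.*` (public:
`normSq_mulVec_le_frobSq_mul`, `normSq_transpose_mulVec_le` = `‖Rᵀ‖_op ≤ ‖R‖_op`,
`spectral_package`, the two Rayleigh ⇄ eigenvalue bounds; cf. the tree's
`LargestEigenvalue.lamMax`, not imported) ·
§2 `mul_qbarClamp_sq_le`, `opNormLe_kernel_of_sketch_events` · §3 `even_sketch_events` ·
§4 `Output.output_error_le_op`, `output_error_mass_center_op` · §5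
`even_polynomial_svt_end_to_end_op` (`t·σ = 432φφ_bd²‖A‖_F²ln(1/δ')/η²` samples of `SQ(b)` in
all) · §6 `matrix_event_blind_example`.
-/

noncomputable section

open scoped Matrix
open Polynomial Finset

namespace Literature.Computability.QuantumComplexity.SampleQuery.EvenPolySVT

/-! ### §1 The operator-norm certificate and a typeclass-free quadratic-form toolkit -/

section opNorm

variable {a s n : ℕ}

/-- **Operator-norm certificate** `‖X‖_op ≤ L` for a rectangular real matrix, as a predicate:
`∀ w, ‖Xw‖ ≤ L‖w‖` (`‖·‖ = √normSq`).  No norm structure on `Fin s → ℝ` is used (Mathlib's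
default is the sup norm); compare `Matrix.PosSemidef` (a predicate, not a number).
[cite: HornJohnson2013, §5.6 Example 5.6.6 (the spectral norm `|||A|||₂ = max_{‖x‖₂=1} ‖Ax‖₂`)] -/
def OpNormLe (X : Matrix (Fin a) (Fin s) ℝ) (L : ℝ) : Prop :=
  ∀ w : Fin s → ℝ, Real.sqrt (normSq (X *ᵥ w)) ≤ L * Real.sqrt (normSq w)

namespace OpNorm

/-- `‖v‖² = v ⬝ᵥ v` (file-private copies in `LinearTimeSVD`, `SparseQSVTEstimation`). [folklore] -/
private theorem normSq_eq_dotProduct (v : Fin s → ℝ) : normSq v = v ⬝ᵥ v := by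
  simp [normSq, dotProduct, pow_two]

/-- `‖Xy‖² ≤ ‖X‖_F²‖y‖²` (Cauchy–Schwarz row by row; file-private in `EvenSVTOutputAccess`,
re-derived). [cite: HornJohnson2013, §5.6 Problem 5.6.P20 (`|||·|||₂ ≤ ‖·‖₂`: the Frobenius norm
dominates the spectral norm)] -/
theorem normSq_mulVec_le_frobSq_mul (X : Matrix (Fin a) (Fin s) ℝ) (y : Fin s → ℝ) :
    normSq (X *ᵥ y) ≤ frobSq X * normSq y := by
  unfold frobSq
  rw [Finset.sum_mul]
  refine Finset.sum_le_sum fun i _ => ?_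
  have h : (X *ᵥ y) i = ∑ j, X i j * y j := rfl
  rw [h]
  exact Finset.sum_mul_sq_le_sq_mul_sq _ _ _

end OpNorm

/-- CONSTRUCTOR: a squared bound `‖Xw‖² ≤ K‖w‖²` certifies `‖X‖_op ≤ √K`.
[cite: HornJohnson2013, §5.6 Example 5.6.6 (the spectral norm as `max_{‖x‖₂=1} ‖Ax‖₂`)] -/
theorem OpNormLe.of_sq_le {X : Matrix (Fin a) (Fin s) ℝ} {K : ℝ} (hK : 0 ≤ K)
    (h : ∀ w, normSq (X *ᵥ w) ≤ K * normSq w) : OpNormLe X (Real.sqrt K) := fun w => by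
  rw [← Real.sqrt_mul hK]
  exact Real.sqrt_le_sqrt (h w)

/-- CONSTRUCTOR `‖X‖_op ≤ ‖X‖_F`: the Frobenius norm is an operator-norm certificate (so the
predicate is never vacuous). [cite: HornJohnson2013, §5.6 Problem 5.6.P20 (`|||·|||₂ ≤ ‖·‖₂`;
held 2012 printing p. 457 L15)] -/
theorem OpNormLe.of_frobSq (X : Matrix (Fin a) (Fin s) ℝ) : OpNormLe X (Real.sqrt (frobSq X)) :=
  OpNormLe.of_sq_le (frobSq_nonneg X) (OpNorm.normSq_mulVec_le_frobSq_mul X)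

/-- CONSTRUCTOR (the `k = 0` / zero-kernel case): the zero matrix has certificate `0`.
[cite: HornJohnson2013, §5.6 Example 5.6.6 (the spectral norm as `max_{‖x‖₂=1} ‖Ax‖₂`)] -/
theorem OpNormLe.zero : OpNormLe (0 : Matrix (Fin a) (Fin s) ℝ) 0 := fun w => by simp [normSq]

namespace OpNorm

/-- `(Ux) ⬝ (Uy) = x ⬝ y` when `UᵀU = 1` (isometry). [folklore] -/
private theorem dotProduct_mulVec_mulVec_of_transpose_mul_self {U : Matrix (Fin a) (Fin s) ℝ}
    (hU : Uᵀ * U = 1) (x y : Fin s → ℝ) : (U *ᵥ x) ⬝ᵥ (U *ᵥ y) = x ⬝ᵥ y := by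
  rw [Matrix.dotProduct_mulVec, ← Matrix.mulVec_transpose, Matrix.mulVec_mulVec, hU,
    Matrix.one_mulVec]

/-- `‖Ux‖² = ‖x‖²` when `UᵀU = 1` (file-private copy in `SparseQSVTEstimation`). [folklore] -/
private theorem normSq_mulVec_of_transpose_mul_self {U : Matrix (Fin a) (Fin s) ℝ} (hU : Uᵀ * U = 1)
    (x : Fin s → ℝ) : normSq (U *ᵥ x) = normSq x := by
  rw [normSq_eq_dotProduct, normSq_eq_dotProduct,
    dotProduct_mulVec_mulVec_of_transpose_mul_self hU]

/-- `‖Rᵀz‖² = z ⬝ (RRᵀ z)`. [folklore] -/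
private theorem normSq_transpose_mulVec (R : Matrix (Fin s) (Fin n) ℝ) (z : Fin s → ℝ) :
    normSq (Rᵀ *ᵥ z) = z ⬝ᵥ ((R * Rᵀ) *ᵥ z) := by
  rw [← Matrix.mulVec_mulVec, Matrix.dotProduct_mulVec z R, ← Matrix.mulVec_transpose,
    normSq_eq_dotProduct]

/-- `‖Au‖² = u ⬝ (AᵀA u)`. [folklore] -/
private theorem normSq_mulVec_eq_dotProduct_gram (A : Matrix (Fin a) (Fin s) ℝ) (u : Fin s → ℝ) :
    normSq (A *ᵥ u) = u ⬝ᵥ ((Aᵀ * A) *ᵥ u) := by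
  have h := normSq_transpose_mulVec Aᵀ u
  simpa only [Matrix.transpose_transpose] using h

/-- `|z ⬝ (E z)| ≤ ‖E‖_F ‖z‖²` (Cauchy–Schwarz and `‖Ez‖ ≤ ‖E‖_F‖z‖`). [folklore] -/
private theorem abs_dotProduct_mulVec_le (E : Matrix (Fin s) (Fin s) ℝ) (z : Fin s → ℝ) :
    |z ⬝ᵥ (E *ᵥ z)| ≤ Real.sqrt (frobSq E) * normSq z := by
  have hcs : (z ⬝ᵥ (E *ᵥ z)) ^ 2 ≤ normSq z * normSq (E *ᵥ z) :=
    Finset.sum_mul_sq_le_sq_mul_sq _ _ _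
  calc |z ⬝ᵥ (E *ᵥ z)| ≤ Real.sqrt (normSq z * normSq (E *ᵥ z)) := Real.abs_le_sqrt hcs
    _ ≤ Real.sqrt (normSq z * (frobSq E * normSq z)) :=
        Real.sqrt_le_sqrt (mul_le_mul_of_nonneg_left (normSq_mulVec_le_frobSq_mul E z)
          (normSq_nonneg z))
    _ = Real.sqrt (frobSq E) * normSq z := by
        rw [show normSq z * (frobSq E * normSq z) = frobSq E * (normSq z * normSq z) by ring,
          Real.sqrt_mul (frobSq_nonneg E), Real.sqrt_mul_self (normSq_nonneg z)]

/-- **`‖Rᵀ‖_op ≤ ‖R‖_op`**, certificate form: `‖Ru‖² ≤ K‖u‖²` for all `u` gives `‖Rᵀv‖² ≤ K‖v‖²`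
for all `v` (`‖Rᵀv‖⁴ = (v ⬝ RRᵀv)² ≤ ‖v‖²‖R(Rᵀv)‖²`). [cite: HornJohnson2013, §5.6
Problem 5.6.P21 (`|||A*|||₂ = |||A|||₂`)] -/
theorem normSq_transpose_mulVec_le (R : Matrix (Fin s) (Fin n) ℝ) {K : ℝ} (hK : 0 ≤ K)
    (h : ∀ u, normSq (R *ᵥ u) ≤ K * normSq u) (v : Fin s → ℝ) :
    normSq (Rᵀ *ᵥ v) ≤ K * normSq v := by
  set u := Rᵀ *ᵥ v with hu
  have h1 : normSq u = v ⬝ᵥ (R *ᵥ u) := by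
    rw [Matrix.dotProduct_mulVec v R u, ← Matrix.mulVec_transpose, normSq_eq_dotProduct]
  have hcs : (v ⬝ᵥ (R *ᵥ u)) ^ 2 ≤ normSq v * normSq (R *ᵥ u) :=
    Finset.sum_mul_sq_le_sq_mul_sq _ _ _
  have h2 : normSq u ^ 2 ≤ normSq v * (K * normSq u) :=
    calc normSq u ^ 2 = (v ⬝ᵥ (R *ᵥ u)) ^ 2 := by rw [h1]
      _ ≤ normSq v * normSq (R *ᵥ u) := hcs
      _ ≤ normSq v * (K * normSq u) := mul_le_mul_of_nonneg_left (h u) (normSq_nonneg v)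
  have hv0 := normSq_nonneg v
  have hu0 := normSq_nonneg u
  by_contra hle
  have hlt : K * normSq v < normSq u := lt_of_not_ge hle
  have hupos : 0 < normSq u := lt_of_le_of_lt (mul_nonneg hK hv0) hlt
  nlinarith

/-- `(U·diag d·Uᵀ) w = U (diag d (Uᵀw))`. [folklore] -/
private theorem conj_diagonal_mulVec (U : Matrix (Fin s) (Fin s) ℝ) (d w : Fin s → ℝ) :
    (U * Matrix.diagonal d * Uᵀ) *ᵥ w = U *ᵥ (Matrix.diagonal d *ᵥ (Uᵀ *ᵥ w)) := by
  simp only [← Matrix.mulVec_mulVec]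

/-- `(U·diag d·Uᵀ)(Ux) = U (diag d x)` when `UᵀU = 1`. [folklore] -/
private theorem conj_diagonal_mulVec_mulVec {U : Matrix (Fin s) (Fin s) ℝ} (hU : Uᵀ * U = 1)
    (d x : Fin s → ℝ) :
    (U * Matrix.diagonal d * Uᵀ) *ᵥ (U *ᵥ x) = U *ᵥ (Matrix.diagonal d *ᵥ x) := by
  have hx : Uᵀ *ᵥ (U *ᵥ x) = x := by rw [Matrix.mulVec_mulVec, hU, Matrix.one_mulVec]
  rw [conj_diagonal_mulVec, hx]

/-- The eigenvector matrix `U` of a real symmetric `H` (Mathlib's `eigenvectorUnitary`) is real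
orthogonal, `H = U·diag(λ)·Uᵀ`, and `g(H) = cfc g H = U·diag(g∘λ)·Uᵀ` — the spectral theorem in
the typeclass-free matrix form this file computes with. [cite: HornJohnson2013, Thm. 4.1.5
(spectral theorem for Hermitian matrices; real symmetric case)] -/
theorem spectral_package {H : Matrix (Fin s) (Fin s) ℝ} (hH : H.IsHermitian) (g : ℝ → ℝ) :
    (hH.eigenvectorUnitary : Matrix (Fin s) (Fin s) ℝ) *
        (hH.eigenvectorUnitary : Matrix (Fin s) (Fin s) ℝ)ᵀ = 1 ∧
      (hH.eigenvectorUnitary : Matrix (Fin s) (Fin s) ℝ)ᵀ *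
        (hH.eigenvectorUnitary : Matrix (Fin s) (Fin s) ℝ) = 1 ∧
      H = (hH.eigenvectorUnitary : Matrix (Fin s) (Fin s) ℝ) * Matrix.diagonal hH.eigenvalues *
        (hH.eigenvectorUnitary : Matrix (Fin s) (Fin s) ℝ)ᵀ ∧
      cfc g H = (hH.eigenvectorUnitary : Matrix (Fin s) (Fin s) ℝ) *
        Matrix.diagonal (g ∘ hH.eigenvalues) *
          (hH.eigenvectorUnitary : Matrix (Fin s) (Fin s) ℝ)ᵀ := by
  classical
  set U : Matrix (Fin s) (Fin s) ℝ := (hH.eigenvectorUnitary : Matrix (Fin s) (Fin s) ℝ) with hU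
  have hU1 : U * Uᵀ = 1 := by
    have h := Unitary.coe_mul_star_self hH.eigenvectorUnitary
    simpa [hU, Matrix.star_eq_conjTranspose, Matrix.conjTranspose_eq_transpose_of_trivial] using h
  have hU2 : Uᵀ * U = 1 := by
    have h := Unitary.coe_star_mul_self hH.eigenvectorUnitary
    simpa [hU, Matrix.star_eq_conjTranspose, Matrix.conjTranspose_eq_transpose_of_trivial] using h
  have hHU : H = U * Matrix.diagonal hH.eigenvalues * Uᵀ := by
    have h := hH.spectral_theorem
    rw [Unitary.conjStarAlgAut_apply] at h
    simpa [hU, Matrix.star_eq_conjTranspose, Matrix.conjTranspose_eq_transpose_of_trivial] using h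
  have hcfc : cfc g H = U * Matrix.diagonal (g ∘ hH.eigenvalues) * Uᵀ := by
    rw [hH.cfc_eq, Matrix.IsHermitian.cfc, Unitary.conjStarAlgAut_apply]
    simp [hU, Matrix.star_eq_conjTranspose, Matrix.conjTranspose_eq_transpose_of_trivial]
  exact ⟨hU1, hU2, hHU, hcfc⟩

/-- **Rayleigh from above ⇒ every eigenvalue is bounded**: if `v ⬝ Hv ≤ Λ‖v‖²` for all `v`
then `λ_j(H) ≤ Λ` (test at the `j`-th eigenvector, `‖Ue_j‖ = 1`).
[cite: HornJohnson2013, Thm. 4.2.2 (Rayleigh quotient theorem)] -/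
theorem eigenvalues_le_of_dotProduct_le {H : Matrix (Fin s) (Fin s) ℝ} (hH : H.IsHermitian)
    {Λ : ℝ} (hΛ : ∀ v : Fin s → ℝ, v ⬝ᵥ (H *ᵥ v) ≤ Λ * normSq v) (j : Fin s) :
    hH.eigenvalues j ≤ Λ := by
  classical
  obtain ⟨-, hU2, -, -⟩ := spectral_package hH id
  set U : Matrix (Fin s) (Fin s) ℝ := (hH.eigenvectorUnitary : Matrix (Fin s) (Fin s) ℝ) with hU
  have hv : H *ᵥ (U *ᵥ Pi.single j 1) = hH.eigenvalues j • (U *ᵥ Pi.single j 1) := by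
    rw [hU, Matrix.IsHermitian.eigenvectorUnitary_mulVec, hH.mulVec_eigenvectorBasis]
  have hn : normSq (U *ᵥ Pi.single j 1) = 1 := by
    rw [normSq_mulVec_of_transpose_mul_self hU2]
    simp [normSq, Pi.single_apply]
  have h := hΛ (U *ᵥ Pi.single j 1)
  rw [hv, dotProduct_smul, smul_eq_mul, ← normSq_eq_dotProduct, hn, mul_one, mul_one] at h
  exact h

/-- **Every eigenvalue bounded ⇒ Rayleigh from above**: `λ_i(H) ≤ Λ` for all `i` gives
`w ⬝ Hw ≤ Λ‖w‖²` (`w ⬝ Hw = Σ λ_i (Uᵀw)_i²`). [cite: HornJohnson2013, Thm. 4.2.2 (Rayleigh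
quotient theorem)] -/
theorem dotProduct_mulVec_le_of_eigenvalues_le {H : Matrix (Fin s) (Fin s) ℝ} (hH : H.IsHermitian)
    {Λ : ℝ} (h : ∀ i, hH.eigenvalues i ≤ Λ) (w : Fin s → ℝ) :
    w ⬝ᵥ (H *ᵥ w) ≤ Λ * normSq w := by
  classical
  obtain ⟨hU1, -, hHU, -⟩ := spectral_package hH id
  set U : Matrix (Fin s) (Fin s) ℝ := (hH.eigenvectorUnitary : Matrix (Fin s) (Fin s) ℝ) with hU
  have hUt : Uᵀᵀ * Uᵀ = 1 := by rw [Matrix.transpose_transpose]; exact hU1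
  have hy : normSq (Uᵀ *ᵥ w) = normSq w := normSq_mulVec_of_transpose_mul_self hUt w
  have hHw : H *ᵥ w = (U * Matrix.diagonal hH.eigenvalues * Uᵀ) *ᵥ w := by rw [← hHU]
  have hq : w ⬝ᵥ (H *ᵥ w) = ∑ i, hH.eigenvalues i * (Uᵀ *ᵥ w) i ^ 2 := by
    rw [hHw, conj_diagonal_mulVec, Matrix.dotProduct_mulVec w U, ← Matrix.mulVec_transpose]
    unfold dotProduct
    exact Finset.sum_congr rfl fun i _ => by rw [Matrix.mulVec_diagonal]; ring
  rw [hq, ← hy, normSq, Finset.mul_sum]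
  exact Finset.sum_le_sum fun i _ => mul_le_mul_of_nonneg_right (h i) (sq_nonneg _)

end OpNorm

end opNorm

/-! ### §2 The operator layer: a sign-free certificate for `‖Rᵀ·q̄_clamp(CCᵀ)‖_op` -/

section operatorLayer

variable {m n s c : ℕ}

open OpNorm

/-- **The Rayleigh weights of `Rᵀq̄_c(CCᵀ)`**: for `deg q ≤ k`, `|q| ≤ 1` on `[0,1]`, `Λ ≥ 1`
and `x ≤ Λ`: `x·q̄_c(x)² ≤ 4k²Λ` — on `[0,1]`, `x q̄_c(x)² = (q(x) − q(0))·q̄(x)` with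
`|q(x) − q(0)| ≤ 2`, `|q̄| ≤ 2k²` (Markov: the tree's `abs_qbarClamp_le` BY NAME); on `(1,Λ]`,
`q̄_c(x) = q(1) − q(0)`; for `x ≤ 0` the weight is `≤ 0`.  Tight at `q = 2x − 1`, `k = 1`,
`x = Λ = 1`. [cite: ChiaEtAl2022, §3.3 Lemma "low-deg-lipschitz" (`max|q̄| ≲ d²`, held arXiv text
p. 20 L58–63) and proof of Theorem 3.4 (even case, p. 21 L16–18)] -/
theorem mul_qbarClamp_sq_le {k : ℕ} {q : ℝ[X]} (hq : q.natDegree ≤ k)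
    (hq1 : ∀ y ∈ Set.Icc (0 : ℝ) 1, |q.eval y| ≤ 1) {Λ x : ℝ} (hΛ : 1 ≤ Λ) (hx : x ≤ Λ) :
    x * qbarClamp q x ^ 2 ≤ 4 * (k : ℝ) ^ 2 * Λ := by
  have hg : |qbarClamp q x| ≤ 2 * (k : ℝ) ^ 2 := by
    have h := abs_qbarClamp_le hq hq1 x
    rwa [mul_one] at h
  have hΛ0 : 0 ≤ Λ := zero_le_one.trans hΛ
  have hK0 : 0 ≤ 4 * (k : ℝ) ^ 2 * Λ := by positivity
  rcases le_or_gt x 0 with hx0 | hx0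
  · nlinarith [sq_nonneg (qbarClamp q x)]
  have hq0 := hq1 0 ⟨le_rfl, zero_le_one⟩
  rcases le_or_gt x 1 with hx1 | hx1
  · -- `x ∈ (0,1]`: `x q̄_c(x) = q(x) − q(0)`
    have hqx := hq1 x ⟨hx0.le, hx1⟩
    have hxq : x * qbarClamp q x = q.eval x - q.eval 0 := qClamp_eq_of_mem q ⟨hx0.le, hx1⟩
    have h2 : |x * qbarClamp q x| ≤ 2 := by
      rw [hxq]
      exact abs_le.2 ⟨by linarith [(abs_le.1 hqx).1, (abs_le.1 hq0).2],
        by linarith [(abs_le.1 hqx).2, (abs_le.1 hq0).1]⟩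
    calc x * qbarClamp q x ^ 2 = (x * qbarClamp q x) * qbarClamp q x := by ring
      _ ≤ |x * qbarClamp q x| * |qbarClamp q x| := by rw [← abs_mul]; exact le_abs_self _
      _ ≤ 2 * (2 * (k : ℝ) ^ 2) := mul_le_mul h2 hg (abs_nonneg _) zero_le_two
      _ ≤ 4 * (k : ℝ) ^ 2 * Λ := by nlinarith
  · -- `x > 1`: `q̄_c(x) = q̄(1) = q(1) − q(0)`
    have hc1 : qbarClamp q x = (divX q).eval 1 := by
      rw [qbarClamp, clamp01, min_eq_right hx1.le, max_eq_right zero_le_one]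
    have hq1' := hq1 1 ⟨zero_le_one, le_rfl⟩
    have h1 : (divX q).eval 1 = q.eval 1 - q.eval 0 := by
      have h := eval_divX_mul q 1
      rwa [one_mul] at h
    have h2 : |qbarClamp q x| ≤ 2 := by
      rw [hc1, h1]
      exact abs_le.2 ⟨by linarith [(abs_le.1 hq1').1, (abs_le.1 hq0).2],
        by linarith [(abs_le.1 hq1').2, (abs_le.1 hq0).1]⟩
    have hgg : qbarClamp q x ^ 2 ≤ 2 * (2 * (k : ℝ) ^ 2) := by
      rw [pow_two, ← abs_mul_abs_self]
      exact mul_le_mul h2 hg (abs_nonneg _) zero_le_two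
    calc x * qbarClamp q x ^ 2 ≤ x * (2 * (2 * (k : ℝ) ^ 2)) :=
          mul_le_mul_of_nonneg_left hgg hx0.le
      _ ≤ Λ * (2 * (2 * (k : ℝ) ^ 2)) := mul_le_mul_of_nonneg_right hx (by positivity)
      _ = 4 * (k : ℝ) ^ 2 * Λ := by ring

/-- Gram matrices are symmetric (file-private in the tree; re-derived). [folklore] -/
private theorem isHermitian_transpose_mul_self' (B : Matrix (Fin c) (Fin s) ℝ) :
    (Bᵀ * B).IsHermitian := by
  simpa [Matrix.conjTranspose_eq_transpose_of_trivial] using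
    Matrix.isHermitian_conjTranspose_mul_self B

/-- **The operator layer of the even singular value transformation (deterministic, sign-free).**
For ANY `R ∈ ℝ^{s×n}`, `T ∈ ℝ^{c×n}`, `A` with `spec(AᵀA) ⊆ (−∞,1]`, `q` with `deg q ≤ k`,
`|q| ≤ 1` on `[0,1]`, and reals `θ₁ ≥ ‖RᵀR − AᵀA‖_F`, `θ₂ ≥ ‖RRᵀ − CCᵀ‖_F` (`C = RTᵀ`,
`CCᵀ = (TRᵀ)ᵀ(TRᵀ)`): **`‖Rᵀ·q̄_clamp(CCᵀ)‖_op ≤ √(4k²(1 + θ₁ + θ₂) + 4k⁴θ₂)`** — degree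
exponent `2` in `k`, `0` at `k = 0`.  Proof, with `M = q̄_c(H)`, `H = CCᵀ` (no `√M` taken):
`‖RᵀMw‖² = Mw ⬝ H(Mw) + Mw ⬝ (RRᵀ − H)(Mw)`; the first term is `Σ_i λ_i q̄_c(λ_i)²(Uᵀw)_i² ≤
4k²Λ‖w‖²` (`M` commutes with `H`; `mul_qbarClamp_sq_le`) where `Λ = 1 + θ₁ + θ₂ ≥ spec(H)` by
Rayleigh (`v ⬝ Hv ≤ ‖Rᵀv‖² + θ₂‖v‖²`, `‖Rᵀv‖² ≤ (1+θ₁)‖v‖²` via `‖Rᵀ‖_op = ‖R‖_op` and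
`u ⬝ RᵀRu ≤ u ⬝ AᵀAu + θ₁‖u‖²`); the second is `≤ θ₂(2k²)²‖w‖²`. [cite: ChiaEtAl2022, §3.3 proof
of Theorem 3.4 (even case, vector step, held arXiv text p. 21 L14–19) with §5.3 proof of Theorem
"evenSing" ((eq:evenSVTbdR)–(eq:evenSVTbdRC), p. 37 L84–102, L134–138); HornJohnson2013,
Thm. 4.2.2 (Rayleigh quotient)] -/
theorem opNormLe_kernel_of_sketch_events {k : ℕ} {q : ℝ[X]} (hq : q.natDegree ≤ k)
    (hq1 : ∀ y ∈ Set.Icc (0 : ℝ) 1, |q.eval y| ≤ 1) {A : Matrix (Fin m) (Fin n) ℝ}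
    (hA1 : ∀ x ∈ spectrum ℝ (Aᵀ * A), x ≤ 1) (R : Matrix (Fin s) (Fin n) ℝ)
    (T : Matrix (Fin c) (Fin n) ℝ) {θ₁ θ₂ : ℝ}
    (h₁ : Real.sqrt (frobSq (Rᵀ * R - Aᵀ * A)) ≤ θ₁)
    (h₂ : Real.sqrt (frobSq (R * Rᵀ - (T * Rᵀ)ᵀ * (T * Rᵀ))) ≤ θ₂) :
    OpNormLe (Rᵀ * cfc (qbarClamp q) ((T * Rᵀ)ᵀ * (T * Rᵀ)))
      (Real.sqrt (4 * (k : ℝ) ^ 2 * (1 + θ₁ + θ₂) + 4 * (k : ℝ) ^ 4 * θ₂)) := by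
  classical
  have hθ₁ : 0 ≤ θ₁ := (Real.sqrt_nonneg _).trans h₁
  have hθ₂ : 0 ≤ θ₂ := (Real.sqrt_nonneg _).trans h₂
  have hΛ1 : (1 : ℝ) ≤ 1 + θ₁ + θ₂ := by linarith
  have hG : (Aᵀ * A).IsHermitian := isHermitian_transpose_mul_self' A
  have hAu : ∀ u : Fin n → ℝ, u ⬝ᵥ ((Aᵀ * A) *ᵥ u) ≤ 1 * normSq u := fun u =>
    dotProduct_mulVec_le_of_eigenvalues_le hG
      (fun i => hA1 _ (hG.eigenvalues_mem_spectrum_real i)) u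
  have hRu : ∀ u : Fin n → ℝ, normSq (R *ᵥ u) ≤ (1 + θ₁) * normSq u := fun u => by
    rw [normSq_mulVec_eq_dotProduct_gram]
    have hsplit : (Rᵀ * R) *ᵥ u = (Aᵀ * A) *ᵥ u + (Rᵀ * R - Aᵀ * A) *ᵥ u := by
      rw [Matrix.sub_mulVec]; abel
    rw [hsplit, dotProduct_add, add_mul, one_mul]
    have hE := (le_abs_self _).trans (abs_dotProduct_mulVec_le (Rᵀ * R - Aᵀ * A) u)
    have hθ : Real.sqrt (frobSq (Rᵀ * R - Aᵀ * A)) * normSq u ≤ θ₁ * normSq u :=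
      mul_le_mul_of_nonneg_right h₁ (normSq_nonneg u)
    linarith [hAu u]
  have hRtv : ∀ v : Fin s → ℝ, normSq (Rᵀ *ᵥ v) ≤ (1 + θ₁) * normSq v :=
    normSq_transpose_mulVec_le R (by linarith) hRu
  set B : Matrix (Fin c) (Fin s) ℝ := T * Rᵀ with hBdef
  set H : Matrix (Fin s) (Fin s) ℝ := Bᵀ * B with hHdef
  have hH : H.IsHermitian := isHermitian_transpose_mul_self' B
  have hHv : ∀ v : Fin s → ℝ, v ⬝ᵥ (H *ᵥ v) ≤ (1 + θ₁ + θ₂) * normSq v := fun v => by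
    have hsplit : H *ᵥ v = (R * Rᵀ) *ᵥ v - (R * Rᵀ - H) *ᵥ v := by
      rw [Matrix.sub_mulVec]; abel
    rw [hsplit, dotProduct_sub, ← normSq_transpose_mulVec, add_mul, add_mul, one_mul]
    have hE : |v ⬝ᵥ ((R * Rᵀ - H) *ᵥ v)| ≤ θ₂ * normSq v :=
      (abs_dotProduct_mulVec_le _ v).trans (mul_le_mul_of_nonneg_right h₂ (normSq_nonneg v))
    linarith [(abs_le.1 hE).1, hRtv v]
  have heig : ∀ i, hH.eigenvalues i ≤ 1 + θ₁ + θ₂ := eigenvalues_le_of_dotProduct_le hH hHv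
  obtain ⟨hU1, hU2, hHU, hcfc⟩ := spectral_package hH (qbarClamp q)
  set U : Matrix (Fin s) (Fin s) ℝ := (hH.eigenvectorUnitary : Matrix (Fin s) (Fin s) ℝ) with hU
  set d : Fin s → ℝ := qbarClamp q ∘ hH.eigenvalues with hddef
  have hdB : ∀ i, d i ^ 2 ≤ (2 * (k : ℝ) ^ 2) ^ 2 := fun i => by
    have h := abs_qbarClamp_le hq hq1 (hH.eigenvalues i)
    rw [mul_one] at h
    have habs := abs_le.1 h
    exact sq_le_sq' habs.1 habs.2
  have hK0 : 0 ≤ 4 * (k : ℝ) ^ 2 * (1 + θ₁ + θ₂) + 4 * (k : ℝ) ^ 4 * θ₂ := by positivity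
  refine OpNormLe.of_sq_le hK0 fun w => ?_
  set y : Fin s → ℝ := Uᵀ *ᵥ w with hydef
  have hUt : Uᵀᵀ * Uᵀ = 1 := by rw [Matrix.transpose_transpose]; exact hU1
  have hy : normSq y = normSq w := normSq_mulVec_of_transpose_mul_self hUt w
  have hMw : cfc (qbarClamp q) H *ᵥ w = U *ᵥ (Matrix.diagonal d *ᵥ y) := by
    rw [hcfc, conj_diagonal_mulVec]
  have hHMw : H *ᵥ (cfc (qbarClamp q) H *ᵥ w) =
      U *ᵥ (Matrix.diagonal hH.eigenvalues *ᵥ (Matrix.diagonal d *ᵥ y)) := by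
    rw [hMw]
    have h : H *ᵥ (U *ᵥ (Matrix.diagonal d *ᵥ y)) =
        (U * Matrix.diagonal hH.eigenvalues * Uᵀ) *ᵥ (U *ᵥ (Matrix.diagonal d *ᵥ y)) := by
      rw [← hHU]
    rw [h, conj_diagonal_mulVec_mulVec hU2]
  have hsplit : (R * Rᵀ) *ᵥ (cfc (qbarClamp q) H *ᵥ w) =
      H *ᵥ (cfc (qbarClamp q) H *ᵥ w) + (R * Rᵀ - H) *ᵥ (cfc (qbarClamp q) H *ᵥ w) := by
    rw [Matrix.sub_mulVec]; abel
  rw [← Matrix.mulVec_mulVec, normSq_transpose_mulVec, hsplit, dotProduct_add]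
  -- first term: `Σ_i λ_i q̄_c(λ_i)² y_i² ≤ 4k²Λ‖w‖²`
  have h1 : (cfc (qbarClamp q) H *ᵥ w) ⬝ᵥ (H *ᵥ (cfc (qbarClamp q) H *ᵥ w)) ≤
      4 * (k : ℝ) ^ 2 * (1 + θ₁ + θ₂) * normSq w := by
    rw [hHMw, hMw, dotProduct_mulVec_mulVec_of_transpose_mul_self hU2]
    have hq' : (Matrix.diagonal d *ᵥ y) ⬝ᵥ
        (Matrix.diagonal hH.eigenvalues *ᵥ (Matrix.diagonal d *ᵥ y)) =
        ∑ i, hH.eigenvalues i * qbarClamp q (hH.eigenvalues i) ^ 2 * y i ^ 2 := by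
      unfold dotProduct
      exact Finset.sum_congr rfl fun i _ => by
        simp only [Matrix.mulVec_diagonal, hddef, Function.comp_apply]; ring
    rw [hq', ← hy, normSq, Finset.mul_sum]
    exact Finset.sum_le_sum fun i _ =>
      mul_le_mul_of_nonneg_right (mul_qbarClamp_sq_le hq hq1 hΛ1 (heig i)) (sq_nonneg _)
  -- second term: `Mw ⬝ (RRᵀ − H)(Mw) ≤ θ₂‖Mw‖² ≤ θ₂(2k²)²‖w‖²`
  have hMn : normSq (cfc (qbarClamp q) H *ᵥ w) ≤ (2 * (k : ℝ) ^ 2) ^ 2 * normSq w := by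
    rw [hMw, normSq_mulVec_of_transpose_mul_self hU2, ← hy]
    unfold normSq
    rw [Finset.mul_sum]
    exact Finset.sum_le_sum fun i _ => by
      rw [Matrix.mulVec_diagonal, mul_pow]
      exact mul_le_mul_of_nonneg_right (hdB i) (sq_nonneg _)
  have h2 : (cfc (qbarClamp q) H *ᵥ w) ⬝ᵥ ((R * Rᵀ - H) *ᵥ (cfc (qbarClamp q) H *ᵥ w)) ≤
      θ₂ * ((2 * (k : ℝ) ^ 2) ^ 2 * normSq w) :=
    (le_abs_self _).trans ((abs_dotProduct_mulVec_le _ _).trans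
      (mul_le_mul h₂ hMn (normSq_nonneg _) hθ₂))
  calc _ ≤ 4 * (k : ℝ) ^ 2 * (1 + θ₁ + θ₂) * normSq w + θ₂ * ((2 * (k : ℝ) ^ 2) ^ 2 * normSq w) :=
        add_le_add h1 h2
    _ = (4 * (k : ℝ) ^ 2 * (1 + θ₁ + θ₂) + 4 * (k : ℝ) ^ 4 * θ₂) * normSq w := by ring

end operatorLayer

/-! ### §3 The two sketch events of the even construction, exposed -/

section events

variable {m n s c : ℕ} {φ : ℝ} {A : Matrix (Fin m) (Fin n) ℝ}

/-- `Σ_{E} w − Σ_{¬G} w ≤ Σ_{E ∧ G} w` for nonnegative weights (file-private in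
`EvenSingularValueTransformation`; re-derived). [folklore] -/
private theorem sum_filter_and_ge'' {ι : Type*} (u : Finset ι) (w : ι → ℝ) (hw : ∀ i, 0 ≤ w i)
    (E G : ι → Prop) [DecidablePred E] [DecidablePred G] :
    ∑ i ∈ u.filter E, w i - ∑ i ∈ u.filter (fun i => ¬ G i), w i ≤
      ∑ i ∈ u.filter (fun i => E i ∧ G i), w i := by
  classical
  have hsplit : ∑ i ∈ u.filter E, w i =
      ∑ i ∈ (u.filter E).filter G, w i + ∑ i ∈ (u.filter E).filter (fun i => ¬ G i), w i :=
    (sum_filter_add_sum_filter_not _ _ _).symm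
  rw [hsplit, filter_filter]
  have hle : ∑ i ∈ (u.filter E).filter (fun i => ¬ G i), w i ≤
      ∑ i ∈ u.filter (fun i => ¬ G i), w i :=
    sum_le_sum_of_subset_of_nonneg (fun i hi => by
      simp only [mem_filter] at hi ⊢; exact ⟨hi.1.1, hi.2⟩) (fun i _ _ => hw i)
  linarith

/-- `‖−X‖_F² = ‖X‖_F²`. [folklore] -/
private theorem frobSq_neg' {k l : ℕ} (X : Matrix (Fin k) (Fin l) ℝ) : frobSq (-X) = frobSq X := by
  simp [frobSq_eq_sum_sq]

/-- **The two sketch events of the even singular value transformation, EXPOSED** — the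
event-exposing variant of the tree's `even_singular_value_transformation`: same two-stage
sampling, same lemmas BY NAME (`approx_matrix_product'` twice, `iid_mass_frobSq_sketch_lt_half_le`,
`sketchPhi_le_two_mul`, `MatrixOversamplingWitness.sketched`/`.transpose`,
`IsOversampledDist.mono`, `frobSq_sketch_mul_le`); the tree theorem is its deterministic tail and
is NOT restated.  `SQ_φ(A)` (`A ≠ 0`), `s, c ≥ 1`, `δ₁, δ₂, δ₃ > 0`, `s ≥ 2φ² ln(1/δ₃)`;
`ω ∈ [m]^s` from `𝒟_ã` (`R_ω = S_ωA`), then `τ ∈ [n]^c` from the row norms of `(S_ωÃ)ᵀ` (`T_τ`):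
the two-stage mass of the RAW, un-joined pair `‖R_ωᵀR_ω − AᵀA‖_F ≤ √(8φ² log(2/δ₁)/s)‖A‖_F² ∧
‖R_ωR_ωᵀ − (T_τR_ωᵀ)ᵀ(T_τR_ωᵀ)‖_F ≤ φ√(32φ² log(2/δ₂)/c)‖A‖_F²` exceeds `1 − δ₁ − δ₂ − δ₃`, so
that BOTH the §2 certificate and the tree's Frobenius chain attach to the same outcome.
[cite: ChiaEtAl2022, §5.3 Theorem "evenSing" and its proof (p. 37)] -/
theorem even_sketch_events (W : MatrixOversamplingWitness φ A) (hA : A ≠ 0)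
    (hs : 0 < s) (hc : 0 < c) {δ₁ δ₂ δ₃ : ℝ} (hδ₁ : 0 < δ₁) (hδ₂ : 0 < δ₂) (hδ₃ : 0 < δ₃)
    (hsδ : 2 * φ ^ 2 * Real.log (1 / δ₃) ≤ s) :
    1 - δ₁ - δ₂ - δ₃ <
      ∑ ω : Fin s → Fin m, iidWeight (rowDist W.tilde) ω *
        ∑ τ ∈ univ.filter (fun τ : Fin c → Fin n =>
          Real.sqrt (frobSq ((sketch (rowDist W.tilde) ω * A)ᵀ * (sketch (rowDist W.tilde) ω * A) -
              Aᵀ * A)) ≤ Real.sqrt (8 * φ ^ 2 * Real.log (2 / δ₁) / s) * frobSq A ∧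
          Real.sqrt (frobSq (sketch (rowDist W.tilde) ω * A * (sketch (rowDist W.tilde) ω * A)ᵀ -
              (sketch (rowDist (sketch (rowDist W.tilde) ω * W.tilde)ᵀ) τ *
                  (sketch (rowDist W.tilde) ω * A)ᵀ)ᵀ *
                (sketch (rowDist (sketch (rowDist W.tilde) ω * W.tilde)ᵀ) τ *
                  (sketch (rowDist W.tilde) ω * A)ᵀ))) ≤
            φ * Real.sqrt (32 * φ ^ 2 * Real.log (2 / δ₂) / c) * frobSq A),
          iidWeight (rowDist (sketch (rowDist W.tilde) ω * W.tilde)ᵀ) τ := by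
  classical
  set p : Fin m → ℝ := rowDist W.tilde with hpdef
  set θ₁ : ℝ := Real.sqrt (8 * φ ^ 2 * Real.log (2 / δ₁) / s) * frobSq A with hθ₁
  set θ₂ : ℝ := φ * Real.sqrt (32 * φ ^ 2 * Real.log (2 / δ₂) / c) * frobSq A with hθ₂
  have hp := W.isOversampledDist_rowDist hA
  have hφ := W.pos hA
  have hF : 0 < frobSq A := frobSq_pos hA
  have hw0 : ∀ ω : Fin s → Fin m, 0 ≤ iidWeight p ω := iidWeight_nonneg hp.nonneg
  let E₁ : (Fin s → Fin m) → Prop := fun ω =>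
    Real.sqrt (frobSq ((sketch p ω * A)ᵀ * (sketch p ω * A) - Aᵀ * A)) < θ₁
  let G : (Fin s → Fin m) → Prop := fun ω => frobSq A / 2 ≤ frobSq (sketch p ω * A)
  have hE₁ : 1 - δ₁ < ∑ ω ∈ univ.filter E₁, iidWeight p ω := by
    have hkey := approx_matrix_product' hp hp hφ hφ hA hA hs hδ₁
    have havg : (fun k => (p k + p k) / 2) = p := funext fun k => by ring
    rw [havg] at hkey
    have hthr' : Real.sqrt (8 * φ * φ * Real.log (2 / δ₁) / s) *
        (Real.sqrt (frobSq A) * Real.sqrt (frobSq A)) = θ₁ := by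
      rw [hθ₁, Real.mul_self_sqrt (frobSq_nonneg A), show (8 : ℝ) * φ * φ = 8 * φ ^ 2 by ring]
    rw [hthr'] at hkey
    exact hkey
  have hG : ∑ ω ∈ univ.filter (fun ω => ¬ G ω), iidWeight p ω ≤ δ₃ := by
    have h := iid_mass_frobSq_sketch_lt_half_le W hA hs hδ₃ hsδ
    refine le_of_eq_of_le (sum_congr ?_ fun _ _ => rfl) h
    ext ω; simp only [mem_filter, mem_univ, true_and, G, not_le, hpdef]
  have hEG : 1 - δ₁ - δ₃ < ∑ ω ∈ univ.filter (fun ω => E₁ ω ∧ G ω), iidWeight p ω := by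
    have := sum_filter_and_ge'' univ (iidWeight p) hw0 E₁ G
    linarith
  let good : (Fin s → Fin m) → (Fin c → Fin n) → Prop := fun ω τ =>
    Real.sqrt (frobSq ((sketch p ω * A)ᵀ * (sketch p ω * A) - Aᵀ * A)) ≤ θ₁ ∧
    Real.sqrt (frobSq (sketch p ω * A * (sketch p ω * A)ᵀ -
        (sketch (rowDist (sketch p ω * W.tilde)ᵀ) τ * (sketch p ω * A)ᵀ)ᵀ *
          (sketch (rowDist (sketch p ω * W.tilde)ᵀ) τ * (sketch p ω * A)ᵀ))) ≤ θ₂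
  have hstage2 : ∀ ω, E₁ ω ∧ G ω →
      1 - δ₂ < ∑ τ ∈ univ.filter (fun τ : Fin c → Fin n => good ω τ),
        iidWeight (rowDist (sketch p ω * W.tilde)ᵀ) τ := by
    rintro ω ⟨hωE, hωG⟩
    set R := sketch p ω * A with hRdef
    have hRpos : 0 < frobSq R := lt_of_lt_of_le (by linarith) hωG
    have hRne : R ≠ 0 := fun h0 => by
      rw [h0] at hRpos; simp [frobSq_eq_sum_sq] at hRpos
    have hRtne : Rᵀ ≠ 0 := fun h0 => hRne (by simpa using congrArg Matrix.transpose h0)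
    let W₂ := (W.sketched ω hRne).transpose
    have hφω : sketchPhi W ω ≤ 2 * φ := sketchPhi_le_two_mul W hA ω hωG
    have hq : IsOversampledDist (2 * φ) (rowNorms Rᵀ) (rowDist (sketch p ω * W.tilde)ᵀ) := by
      have h := W₂.isOversampledDist_rowDist hRtne
      simp only [W₂, MatrixOversamplingWitness.transpose_tilde,
        MatrixOversamplingWitness.sketched_tilde] at h
      exact h.mono (W₂.pos hRtne) hφω
    have h2φ : 0 < 2 * φ := by linarith
    have hkey := approx_matrix_product' hq hq h2φ h2φ hRtne hRtne hc hδ₂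
    have havg : (fun k => (rowDist (sketch p ω * W.tilde)ᵀ k +
        rowDist (sketch p ω * W.tilde)ᵀ k) / 2) = rowDist (sketch p ω * W.tilde)ᵀ :=
      funext fun k => by ring
    rw [havg] at hkey
    have hRle : frobSq R ≤ φ * frobSq A := frobSq_sketch_mul_le hp hφ ω
    have hRtle : frobSq Rᵀ ≤ φ * frobSq A := by rw [frobSq_transpose]; exact hRle
    have hthr2 : Real.sqrt (8 * (2 * φ) * (2 * φ) * Real.log (2 / δ₂) / c) *
        (Real.sqrt (frobSq Rᵀ) * Real.sqrt (frobSq Rᵀ)) ≤ θ₂ := by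
      rw [Real.mul_self_sqrt (frobSq_nonneg _), hθ₂,
        show (8 : ℝ) * (2 * φ) * (2 * φ) = 32 * φ ^ 2 by ring]
      calc Real.sqrt (32 * φ ^ 2 * Real.log (2 / δ₂) / c) * frobSq Rᵀ
          ≤ Real.sqrt (32 * φ ^ 2 * Real.log (2 / δ₂) / c) * (φ * frobSq A) :=
            mul_le_mul_of_nonneg_left hRtle (Real.sqrt_nonneg _)
        _ = φ * Real.sqrt (32 * φ ^ 2 * Real.log (2 / δ₂) / c) * frobSq A := by ring
    refine lt_of_lt_of_le hkey (sum_le_sum_of_subset_of_nonneg ?_ fun τ _ _ =>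
      iidWeight_nonneg hq.nonneg τ)
    intro τ hτ
    simp only [mem_filter, mem_univ, true_and] at hτ ⊢
    set T := sketch (rowDist (sketch p ω * W.tilde)ᵀ) τ with hTdef
    have hev : Real.sqrt (frobSq (R * Rᵀ - (T * Rᵀ)ᵀ * (T * Rᵀ))) ≤ θ₂ := by
      rw [← frobSq_neg', neg_sub]
      have hτ' := hτ
      simp only [Matrix.transpose_transpose] at hτ'
      exact (hτ'.le).trans hthr2
    exact ⟨hωE.le, hev⟩
  have hinner_nonneg : ∀ ω : Fin s → Fin m, 0 ≤ ∑ τ ∈ univ.filter (fun τ : Fin c → Fin n =>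
      good ω τ), iidWeight (rowDist (sketch p ω * W.tilde)ᵀ) τ := fun ω =>
    sum_nonneg fun τ _ =>
      iidWeight_nonneg (fun k => div_nonneg (normSq_nonneg _) (frobSq_nonneg _)) τ
  show 1 - δ₁ - δ₂ - δ₃ < ∑ ω : Fin s → Fin m, iidWeight p ω *
      ∑ τ ∈ univ.filter (fun τ : Fin c → Fin n => good ω τ),
        iidWeight (rowDist (sketch p ω * W.tilde)ᵀ) τ
  rcases le_or_gt 1 δ₂ with hδ₂1 | hδ₂1
  · calc 1 - δ₁ - δ₂ - δ₃ < 0 := by linarith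
      _ ≤ _ := sum_nonneg fun ω _ => mul_nonneg (hw0 ω) (hinner_nonneg ω)
  calc 1 - δ₁ - δ₂ - δ₃ ≤ (1 - δ₁ - δ₃) * (1 - δ₂) := by
        have : 0 ≤ δ₂ * (δ₁ + δ₃) := by positivity
        nlinarith
    _ < (∑ ω ∈ univ.filter (fun ω => E₁ ω ∧ G ω), iidWeight p ω) * (1 - δ₂) :=
        mul_lt_mul_of_pos_right hEG (by linarith)
    _ = ∑ ω ∈ univ.filter (fun ω => E₁ ω ∧ G ω), iidWeight p ω * (1 - δ₂) := by rw [sum_mul]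
    _ ≤ ∑ ω ∈ univ.filter (fun ω => E₁ ω ∧ G ω), iidWeight p ω *
          ∑ τ ∈ univ.filter (fun τ : Fin c → Fin n => good ω τ),
            iidWeight (rowDist (sketch p ω * W.tilde)ᵀ) τ :=
        sum_le_sum fun ω hω => mul_le_mul_of_nonneg_left
          (hstage2 ω (by simpa only [mem_filter, mem_univ, true_and] using hω)).le (hw0 ω)
    _ ≤ _ := sum_le_sum_of_subset_of_nonneg (filter_subset _ _) fun ω _ _ =>
          mul_nonneg (hw0 ω) (hinner_nonneg ω)

end events

/-! ### §4 The vector step with the operator certificate in place of `‖RᵀM‖_F` -/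

namespace Output

variable {n s σ t : ℕ}

/-- Triangle inequality for `√normSq`, from the tree's `vecDist_triangle` BY NAME. [folklore] -/
private theorem sqrt_normSq_add_le' {l : ℕ} (u w : Fin l → ℝ) :
    Real.sqrt (normSq (u + w)) ≤ Real.sqrt (normSq u) + Real.sqrt (normSq w) := by
  simpa [vecDist] using vecDist_triangle (u + w) w 0

/-- **Error propagation with an operator certificate** (the vector step of Theorem 3.4,
deterministic): `‖(RᵀMu + c·b) − Fb‖ ≤ ‖RᵀMR + cI − F‖_F·‖b‖ + L·‖u − Rb‖` whenever
`OpNormLe (RᵀM) L` — the tree's `output_error_le` (`output_sub_eq` BY NAME) with its Frobenius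
factor `‖RᵀM‖_F` replaced by the certificate. [cite: ChiaEtAl2022, §3.3 proof of Theorem 3.4
("`‖R†f̄(CC†)(Rb − u)‖ ≤ ‖R†√f̄(CC†)‖‖√f̄(CC†)‖‖Rb − u‖`", held arXiv text p. 21 L14–16)] -/
theorem output_error_le_op (R : Matrix (Fin s) (Fin n) ℝ) (M : Matrix (Fin s) (Fin s) ℝ)
    (F : Matrix (Fin n) (Fin n) ℝ) (u : Fin s → ℝ) (c : ℝ) (b : Fin n → ℝ) {L : ℝ}
    (hop : OpNormLe (Rᵀ * M) L) :
    Real.sqrt (normSq (Rᵀ *ᵥ (M *ᵥ u) + c • b - F *ᵥ b)) ≤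
      Real.sqrt (frobSq (Rᵀ * M * R + c • (1 : Matrix (Fin n) (Fin n) ℝ) - F)) *
          Real.sqrt (normSq b) + L * Real.sqrt (normSq (u - R *ᵥ b)) := by
  rw [output_sub_eq]
  exact (sqrt_normSq_add_le' _ _).trans (add_le_add (OpNormLe.of_frobSq _ _) (hop _))

/-- **The boosted `u ≈ Rb` step joined to the output error, operator-norm sizing.**  For ANY
`R`, `M` with `OpNormLe (RᵀM) L`, scalar `c`, target `F`, `SQ_{φ_b}(b)` (`b ≠ 0`), `η, δ' > 0`:
with **`σ ≥ 36φ_b‖R‖_F²L²/η²`** samples per copy, `t ≥ 8 ln(1/δ')` copies and any `ℓ²`-centre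
selector, `‖(RᵀMu_* + c·b) − Fb‖ ≤ ‖RᵀMR + cI − F‖_F‖b‖ + η‖b‖` with product mass `≥ 1 − δ'` —
the tree's `output_error_mass_center` with `‖RᵀM‖_F²` replaced by `L²` (`matVecEst_center_near_ge`
BY NAME at `ε = η‖b‖/(3L)`; sure event if `L ≤ 0`). [cite: ChiaEtAl2022, §3.3 proof of
Theorem 3.4 (`Õ(‖A‖_F²‖b‖²d²/ε²)` samples, held arXiv text p. 21 L12–13); Minsker2015, §3
Remark 3.2] -/
theorem output_error_mass_center_op {φb : ℝ} {b : Fin n → ℝ} (wb : OversamplingWitness φb b)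
    (hb : b ≠ 0) (hσ : 0 < σ) (R : Matrix (Fin s) (Fin n) ℝ) (M : Matrix (Fin s) (Fin s) ℝ)
    (F : Matrix (Fin n) (Fin n) ℝ) (c : ℝ) {L η δ' : ℝ} (hop : OpNormLe (Rᵀ * M) L)
    (hη : 0 < η) (hδ' : 0 < δ') (hσL : 36 * φb * frobSq R * L ^ 2 / η ^ 2 ≤ σ) (ht : 0 < t)
    (htδ : 8 * Real.log (1 / δ') ≤ t) (sel : (Fin t → (Fin σ → Fin n)) → Fin t)
    (hsel : ∀ ω, IsCenter vecDist (fun i => matVecEst R b (lengthSqDist wb.tilde) (ω i)) (sel ω)) :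
    1 - δ' ≤
      ∑ ω ∈ univ.filter (fun ω : Fin t → (Fin σ → Fin n) =>
          Real.sqrt (normSq (Rᵀ *ᵥ (M *ᵥ matVecEst R b (lengthSqDist wb.tilde) (ω (sel ω))) +
              c • b - F *ᵥ b)) ≤
            Real.sqrt (frobSq (Rᵀ * M * R + c • (1 : Matrix (Fin n) (Fin n) ℝ) - F)) *
                Real.sqrt (normSq b) +
              η * Real.sqrt (normSq b)),
        iidWeight (iidWeight (lengthSqDist wb.tilde)) ω := by
  classical
  set p := lengthSqDist wb.tilde with hp
  have hdist := wb.isOversampledDist hb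
  have hW0 : ∀ ω : Fin t → (Fin σ → Fin n), 0 ≤ iidWeight (iidWeight p) ω :=
    iidWeight_nonneg (iidWeight_nonneg hdist.nonneg)
  have hbpos : 0 < normSq b := normSq_pos hb
  have hφb : 0 < φb := wb.pos hb
  rcases le_or_gt L 0 with hL0 | hL0
  · rw [filter_true_of_mem fun ω _ => ?_, sum_iidWeight (sum_iidWeight hdist.sum_eq_one)]
    · linarith
    refine (output_error_le_op R M F _ c b hop).trans (add_le_add le_rfl ?_)
    exact (mul_nonpos_iff.2 (Or.inr ⟨hL0, Real.sqrt_nonneg _⟩)).trans (by positivity)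
  have hsqb : 0 < Real.sqrt (normSq b) := Real.sqrt_pos.2 hbpos
  set ε : ℝ := η * Real.sqrt (normSq b) / (3 * L) with hε
  have hεpos : 0 < ε := by positivity
  have hσL' : 4 * φb * (frobSq R * normSq b) / ε ^ 2 ≤ σ := by
    have hε2 : ε ^ 2 = η ^ 2 * normSq b / (9 * L ^ 2) := by
      rw [hε, div_pow, mul_pow, mul_pow, Real.sq_sqrt hbpos.le]
      norm_num
    rw [hε2, show 4 * φb * (frobSq R * normSq b) / (η ^ 2 * normSq b / (9 * L ^ 2)) =
      36 * φb * frobSq R * L ^ 2 / η ^ 2 by field_simp; ring]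
    exact hσL
  refine (matVecEst_center_near_ge wb hb (Nat.pos_iff_ne_zero.mp hσ) R hεpos hσL' ht sel hsel
    hδ' htδ).trans (sum_le_sum_of_subset_of_nonneg (fun ω hω => mem_filter.2 ⟨mem_univ _, ?_⟩)
    (fun ω _ _ => hW0 ω))
  have hle : vecDist (matVecEst R b p (ω (sel ω))) (R *ᵥ b) ≤ 3 * ε := (mem_filter.1 hω).2
  have h3ε : L * (3 * ε) = η * Real.sqrt (normSq b) := by
    rw [hε]; field_simp
  exact (output_error_le_op R M F _ c b hop).trans
    (add_le_add le_rfl (by rw [← h3ε]; exact mul_le_mul_of_nonneg_left hle hL0.le))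

end Output

/-! ### §5 The end-to-end statement with the vector stage sized by the operator certificate -/

section endToEnd

variable {m n s c σ t : ℕ} {φ : ℝ} {A : Matrix (Fin m) (Fin n) ℝ}

/-- Square-root thresholds (file-private in `EvenSingularValueTransformation`; re-derived):
`4aK²ℓ/ε² ≤ u ⇒ K√(aℓ/u) ≤ ε/2`. [folklore] -/
private theorem mul_sqrt_div_le_half' {a K ℓ u ε : ℝ} (ha : 0 ≤ a) (hK : 0 < K) (hℓ : 0 < ℓ)
    (hε : 0 < ε) (hu : 4 * a * K ^ 2 * ℓ / ε ^ 2 ≤ u) : K * Real.sqrt (a * ℓ / u) ≤ ε / 2 := by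
  rcases eq_or_lt_of_le ha with rfl | ha'
  · simp [le_of_lt (half_pos hε)]
  have hu0 : 0 < u := lt_of_lt_of_le (by positivity) hu
  have hq : a * ℓ / u ≤ (ε / (2 * K)) ^ 2 := by
    rw [div_le_iff₀ hu0]
    calc a * ℓ = (ε / (2 * K)) ^ 2 * (4 * a * K ^ 2 * ℓ / ε ^ 2) := by
          field_simp
          ring
      _ ≤ (ε / (2 * K)) ^ 2 * u := mul_le_mul_of_nonneg_left hu (sq_nonneg _)
  calc K * Real.sqrt (a * ℓ / u) ≤ K * (ε / (2 * K)) :=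
        mul_le_mul_of_nonneg_left ((Real.sqrt_le_sqrt hq).trans_eq
          (Real.sqrt_sq (by positivity))) hK.le
    _ = ε / 2 := by field_simp

/-- **Even polynomial SVT from `SQ_φ(A)` and `SQ_{φ_b}(b)` to the output vector, the vector stage
sized by the OPERATOR certificate (CGLLTW Theorem 3.4, even case; degree exponent `2`).**
Data, stages, conclusion and the matrix-stage thresholds VERBATIM as the tree's
`even_polynomial_svt_end_to_end` (`s ≥ 8φ²(2k)⁴‖A‖_F⁴log(6/δ)/ε²`, `s ≥ 2φ²log(3/δ)`,
`c ≥ 8φ⁶(2k)⁸‖A‖_F⁸log(6/δ)/ε²`, `t ≥ 8 ln(1/δ')`), plus TWO VISIBLE EXTRAS — `ε ≤ 1` and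
`c ≥ 8φ⁴(2k)⁸‖A‖_F⁴log(6/δ)` (both inside the print's regime `ε ≲ 1`, `‖A‖_F = 1`) — and the
per-copy vector-stage threshold, side by side in the same symbols (`d = 2k`):
  tree (`‖RᵀM‖_F` sizing)        `σ ≥ 144 φ² φ_b k⁴ ‖A‖_F⁴ / η²`  (`= 9φ²φ_b d⁴‖A‖_F⁴/η²`),
  here (`‖RᵀM‖_op` certificate)  **`σ ≥ 216 φ φ_b k² ‖A‖_F² / η²`**  (`= 54φφ_b d²‖A‖_F²/η²`).
CONCLUSION: the three-stage nested mass of `‖(R_ωᵀM_{ω,τ}u_* + q(0)·b) − q(AᵀA)b‖ ≤ (ε + η)‖b‖`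
exceeds `1 − δ − δ'`.  Proof: `even_sketch_events` at `δ/3`; on a good outcome the tree's
Frobenius chain (`frobNorm_cfc_gram_sub_le` twice, `evenSVT_error_le`, `cfc_qClamp_gram_eq`)
gives matrix error `≤ ε`, and `opNormLe_kernel_of_sketch_events` with `4k²θ₁ ≤ ε ≤ 1`,
`8k⁴θ₂ ≤ 1` gives `L² ≤ 6k²`, so `36φ_b‖R_ω‖_F²L²/η² ≤ σ` (`frobSq_sketch_mul_le`); then
`Output.output_error_mass_center_op` and `nested_mass_three_stage` BY NAME.  Honest price and
scope: see the module docstring (AMP-spectral avoided by paying `θ₁, θ₂` in `Λ`; matrix stage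
Frobenius; sample counts only; even case; real matrices).  Nothing here bears on BQP vs BPP.
[cite: ChiaEtAl2022, §3.3 Theorem 3.4 (even case) and its proof (held arXiv text p. 20 L65 –
p. 21 L22; vector step p. 21 L12–19); Minsker2015, §3 Remark 3.2] -/
theorem even_polynomial_svt_end_to_end_op (W : MatrixOversamplingWitness φ A) (hA : A ≠ 0)
    (hA1 : ∀ x ∈ spectrum ℝ (Aᵀ * A), x ≤ 1) (hs : 0 < s) (hc : 0 < c) {δ ε : ℝ}
    (hδ : 0 < δ) (hδ1 : δ ≤ 1) (hε : 0 < ε) (hε1 : ε ≤ 1) {k : ℕ} (q : ℝ[X])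
    (hq : q.natDegree ≤ k) (hq1 : ∀ y ∈ Set.Icc (0 : ℝ) 1, |q.eval y| ≤ 1)
    (hsL : 8 * φ ^ 2 * (2 * k) ^ 4 * frobSq A ^ 2 * Real.log (6 / δ) / ε ^ 2 ≤ s)
    (hs3 : 2 * φ ^ 2 * Real.log (3 / δ) ≤ s)
    (hcL : 8 * φ ^ 6 * (2 * k) ^ 8 * frobSq A ^ 4 * Real.log (6 / δ) / ε ^ 2 ≤ c)
    (hc1 : 8 * φ ^ 4 * (2 * k) ^ 8 * frobSq A ^ 2 * Real.log (6 / δ) ≤ c)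
    {φb : ℝ} {b : Fin n → ℝ} (wb : OversamplingWitness φb b) (hb : b ≠ 0) (hσ : 0 < σ)
    {η δ' : ℝ} (hη : 0 < η) (hδ' : 0 < δ')
    (hσL : 216 * φ * φb * (k : ℝ) ^ 2 * frobSq A / η ^ 2 ≤ σ)
    (ht : 0 < t) (htδ : 8 * Real.log (1 / δ') ≤ t)
    (sel : (Fin s → Fin m) → (Fin t → (Fin σ → Fin n)) → Fin t)
    (hsel : ∀ ω ξ, IsCenter Output.vecDist (fun i =>
      Output.matVecEst (sketch (rowDist W.tilde) ω * A) b (lengthSqDist wb.tilde) (ξ i))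
      (sel ω ξ)) :
    1 - δ - δ' <
      ∑ ω : Fin s → Fin m, iidWeight (rowDist W.tilde) ω *
        ∑ τ : Fin c → Fin n, iidWeight (rowDist (sketch (rowDist W.tilde) ω * W.tilde)ᵀ) τ *
          ∑ ξ ∈ univ.filter (fun ξ : Fin t → (Fin σ → Fin n) =>
            Real.sqrt (normSq ((sketch (rowDist W.tilde) ω * A)ᵀ *ᵥ
                (cfc (qbarClamp q) ((sketch (rowDist (sketch (rowDist W.tilde) ω * W.tilde)ᵀ) τ *
                    (sketch (rowDist W.tilde) ω * A)ᵀ)ᵀ *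
                  (sketch (rowDist (sketch (rowDist W.tilde) ω * W.tilde)ᵀ) τ *
                    (sketch (rowDist W.tilde) ω * A)ᵀ)) *ᵥ
                  Output.matVecEst (sketch (rowDist W.tilde) ω * A) b (lengthSqDist wb.tilde)
                    (ξ (sel ω ξ))) +
                (q.eval 0) • b - (aeval (Aᵀ * A) q) *ᵥ b)) ≤
              (ε + η) * Real.sqrt (normSq b)),
            iidWeight (iidWeight (lengthSqDist wb.tilde)) ξ := by
  classical
  have hφ : 0 < φ := W.pos hA
  have hφb : 0 < φb := wb.pos hb
  have hF : 0 < frobSq A := frobSq_pos hA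
  have hdistA := W.isOversampledDist_rowDist hA
  have hdistb := wb.isOversampledDist hb
  have hℓ : 0 < Real.log (6 / δ) := Real.log_pos (by rw [lt_div_iff₀ hδ]; linarith)
  have hw₁ : ∀ ω : Fin s → Fin m, 0 ≤ iidWeight (rowDist W.tilde) ω :=
    iidWeight_nonneg hdistA.nonneg
  have hw₂ : ∀ (ω : Fin s → Fin m) (τ : Fin c → Fin n),
      0 ≤ iidWeight (rowDist (sketch (rowDist W.tilde) ω * W.tilde)ᵀ) τ := fun ω =>
    iidWeight_nonneg fun i => div_nonneg (normSq_nonneg _) (frobSq_nonneg _)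
  have hw₃ : ∀ ξ : Fin t → (Fin σ → Fin n), 0 ≤ iidWeight (iidWeight (lengthSqDist wb.tilde)) ξ :=
    iidWeight_nonneg (iidWeight_nonneg hdistb.nonneg)
  have hδ3 : 0 < δ / 3 := by positivity
  have hev := even_sketch_events W hA hs hc hδ3 hδ3 hδ3
    (by rwa [show (1 : ℝ) / (δ / 3) = 3 / δ by rw [div_div_eq_mul_div, one_mul]])
  rw [show 1 - δ / 3 - δ / 3 - δ / 3 = 1 - δ by ring,
    show (2 : ℝ) / (δ / 3) = 6 / δ by rw [div_div_eq_mul_div]; norm_num] at hev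
  set θ₁ : ℝ := Real.sqrt (8 * φ ^ 2 * Real.log (6 / δ) / s) * frobSq A with hθ₁
  set θ₂ : ℝ := φ * Real.sqrt (32 * φ ^ 2 * Real.log (6 / δ) / c) * frobSq A with hθ₂
  have hθ₁0 : 0 ≤ θ₁ := by rw [hθ₁]; positivity
  have hθ₂0 : 0 ≤ θ₂ := by rw [hθ₂]; positivity
  set K : ℝ := 4 * (k : ℝ) ^ 2 * (1 + θ₁ + θ₂) + 4 * (k : ℝ) ^ 4 * θ₂ with hK
  have hK0 : 0 ≤ K := by rw [hK]; positivity
  have hL0 : (0 : ℝ) ≤ 2 * (k : ℝ) ^ 2 * 1 := by positivity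
  have hLb0 : (0 : ℝ) ≤ 4 * (k : ℝ) ^ 4 * 1 := by positivity
  have hL : ∀ x y : ℝ, 0 ≤ x → 0 ≤ y →
      |qClamp q x - qClamp q y| ≤ 2 * (k : ℝ) ^ 2 * 1 * |x - y| :=
    fun x y hx hy => abs_qClamp_sub_le hq hq1 hx hy
  have hLb : ∀ x y : ℝ, 0 ≤ x → 0 ≤ y →
      |qbarClamp q x - qbarClamp q y| ≤ 4 * (k : ℝ) ^ 4 * 1 * |x - y| :=
    fun x y _ _ => abs_qbarClamp_sub_le hq hq1 x y
  have hff : ∀ x : ℝ, 0 ≤ x → x * qbarClamp q x = qClamp q x := fun x _ => rfl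
  obtain ⟨hB1, hB2, hK6⟩ : 2 * (k : ℝ) ^ 2 * 1 * θ₁ ≤ ε / 2 ∧
      φ * frobSq A * (4 * (k : ℝ) ^ 4 * 1 * θ₂) ≤ ε / 2 ∧ K ≤ 6 * (k : ℝ) ^ 2 := by
    rcases Nat.eq_zero_or_pos k with hk | hk
    · subst hk
      exact ⟨by simp [le_of_lt (half_pos hε)], by simp [le_of_lt (half_pos hε)], by simp [hK]⟩
    have hk1 : (1 : ℝ) ≤ k := Nat.one_le_cast.2 hk
    have h1 := mul_sqrt_div_le_half' (a := 8 * φ ^ 2) (K := 2 * (k : ℝ) ^ 2 * frobSq A)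
      (ℓ := Real.log (6 / δ)) (u := (s : ℝ)) (by positivity) (by positivity) hℓ hε (by
        calc 4 * (8 * φ ^ 2) * (2 * (k : ℝ) ^ 2 * frobSq A) ^ 2 * Real.log (6 / δ) / ε ^ 2
            = 8 * φ ^ 2 * (2 * k) ^ 4 * frobSq A ^ 2 * Real.log (6 / δ) / ε ^ 2 := by ring
          _ ≤ (s : ℝ) := hsL)
    have h2 := mul_sqrt_div_le_half' (a := 32 * φ ^ 2) (K := 4 * (k : ℝ) ^ 4 * φ ^ 2 * frobSq A ^ 2)
      (ℓ := Real.log (6 / δ)) (u := (c : ℝ)) (by positivity) (by positivity) hℓ hε (by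
        calc 4 * (32 * φ ^ 2) * (4 * (k : ℝ) ^ 4 * φ ^ 2 * frobSq A ^ 2) ^ 2 * Real.log (6 / δ) /
              ε ^ 2 = 8 * φ ^ 6 * (2 * k) ^ 8 * frobSq A ^ 4 * Real.log (6 / δ) / ε ^ 2 := by ring
          _ ≤ (c : ℝ) := hcL)
    have h3 := mul_sqrt_div_le_half' (a := 32 * φ ^ 2) (K := 4 * (k : ℝ) ^ 4 * φ * frobSq A)
      (ℓ := Real.log (6 / δ)) (u := (c : ℝ)) (by positivity) (by positivity) hℓ one_pos (by
        calc 4 * (32 * φ ^ 2) * (4 * (k : ℝ) ^ 4 * φ * frobSq A) ^ 2 * Real.log (6 / δ) / 1 ^ 2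
            = 8 * φ ^ 4 * (2 * k) ^ 8 * frobSq A ^ 2 * Real.log (6 / δ) := by ring
          _ ≤ (c : ℝ) := hc1)
    have hB1 : 2 * (k : ℝ) ^ 2 * 1 * θ₁ ≤ ε / 2 :=
      calc 2 * (k : ℝ) ^ 2 * 1 * θ₁
          = 2 * (k : ℝ) ^ 2 * frobSq A * Real.sqrt (8 * φ ^ 2 * Real.log (6 / δ) / s) := by
            rw [hθ₁]; ring
        _ ≤ ε / 2 := h1
    have e2 : 8 * (k : ℝ) ^ 4 * θ₂ ≤ 1 :=
      calc 8 * (k : ℝ) ^ 4 * θ₂ = 2 * (4 * (k : ℝ) ^ 4 * φ * frobSq A *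
            Real.sqrt (32 * φ ^ 2 * Real.log (6 / δ) / c)) := by rw [hθ₂]; ring
        _ ≤ 2 * (1 / 2) := mul_le_mul_of_nonneg_left h3 zero_le_two
        _ = 1 := by norm_num
    have hk24 : (k : ℝ) ^ 2 * θ₂ ≤ (k : ℝ) ^ 4 * θ₂ :=
      mul_le_mul_of_nonneg_right (pow_le_pow_right₀ hk1 (by norm_num)) hθ₂0
    have hk2 : (1 : ℝ) ≤ (k : ℝ) ^ 2 := one_le_pow₀ hk1
    refine ⟨hB1, ?_, by rw [hK]; nlinarith⟩
    calc φ * frobSq A * (4 * (k : ℝ) ^ 4 * 1 * θ₂) = 4 * (k : ℝ) ^ 4 * φ ^ 2 * frobSq A ^ 2 *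
          Real.sqrt (32 * φ ^ 2 * Real.log (6 / δ) / c) := by rw [hθ₂]; ring
      _ ≤ ε / 2 := h2
  have hdet : ∀ (R : Matrix (Fin s) (Fin n) ℝ) (T : Matrix (Fin c) (Fin n) ℝ),
      frobSq R ≤ φ * frobSq A →
      Real.sqrt (frobSq (Rᵀ * R - Aᵀ * A)) ≤ θ₁ →
      Real.sqrt (frobSq (R * Rᵀ - (T * Rᵀ)ᵀ * (T * Rᵀ))) ≤ θ₂ →
      Real.sqrt (frobSq (Rᵀ * cfc (qbarClamp q) ((T * Rᵀ)ᵀ * (T * Rᵀ)) * R +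
          (q.eval 0) • (1 : Matrix (Fin n) (Fin n) ℝ) - aeval (Aᵀ * A) q)) ≤ ε ∧
        OpNormLe (Rᵀ * cfc (qbarClamp q) ((T * Rᵀ)ᵀ * (T * Rᵀ))) (Real.sqrt K) ∧
        36 * φb * frobSq R * Real.sqrt K ^ 2 / η ^ 2 ≤ σ := by
    intro R T hR h₁ h₂
    refine ⟨?_, opNormLe_kernel_of_sketch_events hq hq1 hA1 R T h₁ h₂, ?_⟩
    · -- Lemma 5.4 twice and the decomposition `evenSVT_error_le` (the tree's deterministic tail)
      have h54₁ : Real.sqrt (frobSq (cfc (qClamp q) (Rᵀ * R) - cfc (qClamp q) (Aᵀ * A))) ≤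
          2 * (k : ℝ) ^ 2 * 1 * θ₁ :=
        (frobNorm_cfc_gram_sub_le R A (qClamp q) hL0 hL).trans (mul_le_mul_of_nonneg_left h₁ hL0)
      have h54₂ : Real.sqrt (frobSq (cfc (qbarClamp q) (R * Rᵀ) -
          cfc (qbarClamp q) ((T * Rᵀ)ᵀ * (T * Rᵀ)))) ≤ 4 * (k : ℝ) ^ 4 * 1 * θ₂ := by
        have h := frobNorm_cfc_gram_sub_le Rᵀ (T * Rᵀ) (qbarClamp q) hLb0 hLb
        simp only [Matrix.transpose_transpose] at h
        exact h.trans (mul_le_mul_of_nonneg_left h₂ hLb0)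
      have hdec := evenSVT_error_le R (T * Rᵀ)ᵀ A (qClamp q) (qbarClamp q) hff
      simp only [Matrix.transpose_transpose] at hdec
      have hRθ :
          frobSq R * (4 * (k : ℝ) ^ 4 * 1 * θ₂) ≤ φ * frobSq A * (4 * (k : ℝ) ^ 4 * 1 * θ₂) :=
        mul_le_mul_of_nonneg_right hR (mul_nonneg hLb0 hθ₂0)
      have hfin : Real.sqrt (frobSq (Rᵀ * cfc (qbarClamp q) ((T * Rᵀ)ᵀ * (T * Rᵀ)) * R -
          cfc (qClamp q) (Aᵀ * A))) ≤ ε :=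
        calc _ ≤ _ := hdec
          _ ≤ 2 * (k : ℝ) ^ 2 * 1 * θ₁ + frobSq R * (4 * (k : ℝ) ^ 4 * 1 * θ₂) :=
              add_le_add h54₁ (mul_le_mul_of_nonneg_left h54₂ (frobSq_nonneg R))
          _ ≤ ε / 2 + ε / 2 := add_le_add hB1 (hRθ.trans hB2)
          _ = ε := by ring
      rw [cfc_qClamp_gram_eq q hA1, sub_sub_eq_add_sub] at hfin
      exact hfin
    · -- `36φ_b‖R‖_F²K/η² ≤ 36φ_b(φ‖A‖_F²)(6k²)/η² = 216φφ_bk²‖A‖_F²/η² ≤ σ`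
      rw [Real.sq_sqrt hK0]
      have h : 36 * φb * frobSq R * K ≤ 36 * φb * (φ * frobSq A) * (6 * (k : ℝ) ^ 2) :=
        mul_le_mul (mul_le_mul_of_nonneg_left hR (by positivity)) hK6 hK0 (by positivity)
      calc 36 * φb * frobSq R * K / η ^ 2 ≤ 36 * φb * (φ * frobSq A) * (6 * (k : ℝ) ^ 2) / η ^ 2 :=
            div_le_div_of_nonneg_right h (by positivity)
        _ = 216 * φ * φb * (k : ℝ) ^ 2 * frobSq A / η ^ 2 := by ring
        _ ≤ σ := hσL
  have hd := fun (ω : Fin s → Fin m) (τ : Fin c → Fin n) => hdet (sketch (rowDist W.tilde) ω * A)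
    (sketch (rowDist (sketch (rowDist W.tilde) ω * W.tilde)ᵀ) τ) (frobSq_sketch_mul_le hdistA hφ ω)
  refine nested_mass_three_stage hw₁ hw₂ hw₃ hδ hδ'.le hev
    (fun ω τ hτ => Output.output_error_mass_center_op wb hb hσ _ _ (aeval (Aᵀ * A) q) (q.eval 0)
      (hd ω τ (mem_filter.1 hτ).2.1 (mem_filter.1 hτ).2.2).2.1 hη hδ'
      (hd ω τ (mem_filter.1 hτ).2.1 (mem_filter.1 hτ).2.2).2.2 ht htδ (sel ω) (hsel ω))
    (fun ω τ hτ ξ hξ => ?_)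
  rw [mem_filter] at hξ ⊢
  refine ⟨mem_univ _, hξ.2.trans ?_⟩
  rw [add_mul]
  exact add_le_add (mul_le_mul_of_nonneg_right
    (hd ω τ (mem_filter.1 hτ).2.1 (mem_filter.1 hτ).2.2).1 (Real.sqrt_nonneg _)) le_rfl

/-! ### §6 Why the final matrix event alone cannot size the vector step -/

/-- **The final matrix event is blind to `‖RᵀM‖` for an indefinite kernel** (why §3 exposes the
sketch events, and why the print's `‖R†√M‖ = √‖R†MR‖` needs `M ⪰ 0`): `R = (1, 1)ᵀ`,
`M = diag(1, −1)`: `RᵀMR = 0` yet `RᵀM = (1, −1) ≠ 0`. [cite: ChiaEtAl2022, §5.3 proof of Theorem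
"evenSing", (eq:evenSVTbdRC) (held arXiv text p. 37 L134–138; valid for `f̄(CC†) ⪰ 0` only)] -/
theorem matrix_event_blind_example :
    (!![1; 1] : Matrix (Fin 2) (Fin 1) ℝ)ᵀ * Matrix.diagonal (![1, -1] : Fin 2 → ℝ) *
        (!![1; 1] : Matrix (Fin 2) (Fin 1) ℝ) = 0 ∧
      (!![1; 1] : Matrix (Fin 2) (Fin 1) ℝ)ᵀ * Matrix.diagonal (![1, -1] : Fin 2 → ℝ) ≠ 0 := by
  refine ⟨?_, fun h => ?_⟩
  · ext i j
    fin_cases i; fin_cases j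
    simp [Matrix.mul_apply, Fin.sum_univ_two]
  · have h00 := congrFun (congrFun h 0) 0
    simp [Matrix.mul_apply, Fin.sum_univ_two] at h00

end endToEnd

end Literature.Computability.QuantumComplexity.SampleQuery.EvenPolySVT
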